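import Summits.BirchSwinnertonDyer.BirchSwinnertonDyer.Theorems.GenusKolyvaginAtTwoPowDvdShaCardAtTwoRTTwoClassChebotarev
import Summits.BirchSwinnertonDyer.BirchSwinnertonDyer.Theorems.GenusKolyvaginAtTwoPowDvdShaCardAtTwoRTPrimeSwappingWeak
import Summits.BirchSwinnertonDyer.BirchSwinnertonDyer.Theorems.GenusKolyvaginAtTwoEquivariantChebotarevAtTwoSigned
import HarnessLib

/-!
# Route `GenusKolyvaginAtTwo`, crux L_T `PowDvdShaCardAtTwoRT` (stmt-BirchSwinnertonDyer-23242), LINE 18/19 stub 3a⁗, step (b):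
# the FULL-ORDER PAIR Čebotarev — two classes of orders `2^m`, `2^κ` both given FULL local order at one Kolyvagin prime

Seat `bsd-line-gk2-p2` g16 (PROVER seat 2/3, cell `bsd-f1-sign2`), `--supports 23242 --as helper`; sequel of `…RTTwoClassChebotarev`
(order `2` × order `2`) and `…RTMixedPairChebotarev` (order `2` × order `2^κ`), using the socle lemmas of `…RTPrimeSwappingWeak`. THEOREMS ONLY. BSD is not proved by any of this; neither
is the crux.

Every repaired swap engine of the cell prescribes FULL local orders of TWO deep classes at the new prime `λ′` (memo
`Cruxes/PowDvdShaCardAtTwoRT/Lines/plus-descent-step-b-prop52.md` Addendum 3 (F2)(b): `{c_{M_r+1}(n), y}`; LEAD gk2-p1 g15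
`swapOracle_of_twoPrimeReciprocity`, hypothesis `hceb`: full local order of `c_M(n/ℓ₀)` and of `c_M(n)`; the ℚ-side bottom-rung engine:
`c_L(n)` of order `2^L` and an auxiliary class of order `4`). This file is that prescription from Q5R `EquivariantChebotarevAtTwoR` BY
NAME in its SIGNED form (`GenusExact.equivariantChebotarevAtTwo_eigen_of_not_isSquare`: eigenclasses `c_* x = ±x` of BOTH signs —
the swap pairs a class of sign `ε_r` with a test class of sign `ε_{r+1} = −ε_r`), with the dependent case resolved by SOCLES: two cyclic
`2`-groups `⟨x⟩`, `⟨y⟩` meet non-trivially iff their socles `2^{m−1}x`, `2^{κ−1}y` coincide (§1); if they coincide, full local order of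
`x` alone forces full local order of `y` (the common socle is non-zero at `λ`); if not, `{x, y}` is an independent pair of eigenclasses
and signed Q5R prescribes `(N_x, N_y) = (m, κ)`. No third class, so no Klein-four residue (LEAD `…RTKleinDetect`).

* §1 `dvd_of_zsmul_add_zsmul_eq_zero_of_socle_ne` — independence of `{x, y}` when the socles differ;
* §2 **`infinite_kolyvaginPrime_localization_fullOrder_pair`** — on the Q5R habitat, for EIGENCLASSES `x, y ∈ H¹(K, E[2^M])`
  (`c_* x = ±x`, `c_* y = ±y`, any signs) of orders `2^m, 2^κ` (`m, κ ≥ 1`) with Q5R's separation hypothesis on `⟨x, y⟩`: infinitely many Kolyvagin primes `ℓ` at `2` of index `≥ M`,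
  `Frob_ℓ = Frob_∞`, at whose place `ord x_λ = 2^m` AND `ord y_λ = 2^κ` (tree currency: `2^j·x ∈ torsionLocalKer_λ ⟺ m ≤ j`, same for `y`).

References: [McCallumLMS1991] §3 Cor. 3.2 (prescribed local orders of an independent family); §5 Prop. 5.2 (proof, (11)–(13)).
-/

set_option autoImplicit false
-- `Summit.<P>.<Sub>` repeats `BirchSwinnertonDyer` by the tree's layout convention (D-0017)
set_option linter.dupNamespace false

noncomputable section

open scoped Classical

namespace Summit.BirchSwinnertonDyer.BirchSwinnertonDyer.Theorems.GenusExact.PlusDescent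

open WeierstrassCurve NumberField IsDedekindDomain Field
open Literature.NumberTheory.GaloisRepresentations Literature.NumberTheory.EllipticCurves
open Literature.NumberTheory

/-! ## §1 Two cyclic `2`-groups with distinct socles are independent -/

section Socle

variable {A : Type*} [AddCommGroup A]

/-- **Distinct socles ⟹ independence.** If `ord x = 2^m`, `ord y = 2^κ` (`m, κ ≥ 1`) and the socles differ, `2^{m−1}x ≠ 2^{κ−1}y`,
then `a·x + b·y = 0` forces `2^m ∣ a` and `2^κ ∣ b`: a non-zero `w = a·x = −b·y ∈ ⟨x⟩ ∩ ⟨y⟩` would have a non-zero multiple `u`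
killed by `2`, which generates the socle of BOTH cyclic groups (`mem_zmultiples_of_socle`: `⟨u⟩ = {0, u}` contains `2^{m−1}x` and
`2^{κ−1}y`, both non-zero). [cite: McCallumLMS1991, §3 (definition before Cor. 3.2)] -/
theorem dvd_of_zsmul_add_zsmul_eq_zero_of_socle_ne {x y : A} {m κ : ℕ} (hm : 1 ≤ m) (hκ : 1 ≤ κ)
    (hx : addOrderOf x = 2 ^ m) (hy : addOrderOf y = 2 ^ κ) (hne : 2 ^ (m - 1) • x ≠ 2 ^ (κ - 1) • y)
    {a b : ℤ} (h : a • x + b • y = 0) : ((2 ^ m : ℕ) : ℤ) ∣ a ∧ ((2 ^ κ : ℕ) : ℤ) ∣ b := by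
  -- the common element `w = a • x = -(b • y)`
  have hw : a • x = -(b • y) := eq_neg_of_add_eq_zero_left h
  have hw0 : a • x = 0 := by
    by_contra hw0
    -- `w` is killed by `2^m`
    have hkill : 2 ^ m • (a • x) = 0 := by
      rw [smul_comm, ← hx, addOrderOf_nsmul_eq_zero, smul_zero]
    obtain ⟨k, hk, h2k⟩ := exists_pow_nsmul_ne_zero_and_p_nsmul_eq_zero hkill hw0
    -- `u := 2^k • w` is the socle of `⟨x⟩` …
    have hux : 2 ^ k • (a • x) ∈ AddSubgroup.zmultiples x :=
      AddSubgroup.nsmul_mem _ (AddSubgroup.zsmul_mem _ (AddSubgroup.mem_zmultiples x) a) _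
    have huy : 2 ^ k • (a • x) ∈ AddSubgroup.zmultiples y := by
      rw [hw, smul_neg]
      exact AddSubgroup.neg_mem _ (AddSubgroup.nsmul_mem _ (AddSubgroup.zsmul_mem _ (AddSubgroup.mem_zmultiples y) b) _)
    -- a non-zero `u` killed by `2` in a cyclic `2`-group `⟨z⟩` of order `2^e` is the socle `2^{e-1} • z`
    have socle : ∀ {z : A} {e : ℕ}, 1 ≤ e → addOrderOf z = 2 ^ e → 2 ^ k • (a • x) ∈ AddSubgroup.zmultiples z →
        2 ^ (e - 1) • z = 2 ^ k • (a • x) := by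
      intro z e he hz hmem
      obtain ⟨hγ0, hγ2, hγmem⟩ := pow_pred_nsmul_socle he hz Nat.prime_two
      have hγu := mem_zmultiples_of_socle Nat.prime_two hγmem hγ2 hmem h2k hk
      rw [AddSubgroup.mem_zmultiples_iff] at hγu
      obtain ⟨j, hj⟩ := hγu
      rcases Int.even_or_odd j with hj2 | hj2
      · rw [zsmul_eq_zero_of_even_of_two_nsmul_eq_zero h2k hj2] at hj
        exact absurd hj.symm hγ0
      · rw [zsmul_eq_self_of_odd_of_two_nsmul_eq_zero h2k hj2] at hj
        exact hj.symm
    exact hne ((socle hm hx hux).trans (socle hκ hy huy).symm)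
  have hb0 : b • y = 0 := by rwa [hw0, zero_add] at h
  refine ⟨?_, ?_⟩
  · rw [← hx]; exact addOrderOf_dvd_iff_zsmul_eq_zero.mpr hw0
  · rw [← hy]; exact addOrderOf_dvd_iff_zsmul_eq_zero.mpr hb0

/-- A class of order `2^m` with `1 ≤ m` is non-zero. [folklore] -/
theorem ne_zero_of_addOrderOf_eq_two_pow {x : A} {m : ℕ} (hm : 1 ≤ m) (hx : addOrderOf x = 2 ^ m) : x ≠ 0 := by
  intro h
  rw [h, addOrderOf_zero] at hx
  have : 2 ≤ 2 ^ m := by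
    calc (2 : ℕ) = 2 ^ 1 := (pow_one 2).symm
      _ ≤ 2 ^ m := Nat.pow_le_pow_right (by norm_num) hm
  omega

end Socle

/-! ## §2 The full-order pair Čebotarev at `2` -/

section Chebotarev

variable {K : Type} [Field K] [NumberField K]

/-- Local full order from the socle: in a subgroup `T` (a local kernel), if the socle `2^{κ−1}·y` of a class of order `2^κ` is NOT in
`T`, then `2^j·y ∈ T ⟺ κ ≤ j`. [folklore] -/
theorem pow_zsmul_mem_iff_of_socle_not_mem {V : Type*} [AddCommGroup V] (T : AddSubgroup V) {y : V} {κ : ℕ} (hκ : 1 ≤ κ)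
    (hy : addOrderOf y = 2 ^ κ) (hsoc : (((2 ^ (κ - 1) : ℕ) : ℤ)) • y ∉ T) (j : ℕ) :
    (((2 ^ j : ℕ) : ℤ)) • y ∈ T ↔ κ ≤ j := by
  constructor
  · intro hj
    by_contra hlt
    push Not at hlt
    -- `2^{κ-1} • y = 2^{κ-1-j} • (2^j • y) ∈ T`
    apply hsoc
    have : (((2 ^ (κ - 1) : ℕ) : ℤ)) • y = (((2 ^ (κ - 1 - j) : ℕ) : ℤ)) • ((((2 ^ j : ℕ) : ℤ)) • y) := by
      rw [smul_smul, ← Nat.cast_mul, ← pow_add, Nat.sub_add_cancel (by omega)]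
    rw [this]
    exact T.zsmul_mem hj _
  · intro hj
    have h0 : (((2 ^ j : ℕ) : ℤ)) • y = 0 := by
      rw [← addOrderOf_dvd_iff_zsmul_eq_zero, hy]
      exact_mod_cast pow_dvd_pow 2 hj
    rw [h0]
    exact T.zero_mem

/-- **THE FULL-ORDER PAIR ČEBOTAREV AT `2`.** On the Q5R habitat (`E/ℚ` non-CM, `Δ < 0`, `ρ_{E,2^∞}` onto; `K` imaginary quadratic with
`K ≠ ℚ(√Δ_E)`; `c ≠ 1` in `Gal(K/ℚ)`; `M ≥ 1`): for eigenclasses `x, y ∈ H¹(K, E[2^M])` of orders `2^m`, `2^κ` (`m, κ ≥ 1`),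
with Q5R's separation hypothesis on `⟨x, y⟩`, there are infinitely many Kolyvagin primes `ℓ` at `2` of index `≥ M` with
`Frob_ℓ = Frob_∞` on `K(E[2^M])` at whose place **`x` has local order exactly `2^m` AND `y` has local order exactly `2^κ`** — for
eigenclasses of EITHER sign each (`c_* x = ±x`, `c_* y = ±y`). In the
repaired swap engines: `(x, y) = (c_{M_r+1}(n), y_aux)`, or `(c_M(n/ℓ₀), c_M(n))` (LEAD's two-prime engine), or `(c_L(n), ỹ)` (ℚ-side
bottom rung). Proof: if the socles coincide, signed Q5R for `{x}` with `N = m` and the common socle transports full order to `y`;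
otherwise `{x, y}` is independent (§1) and signed Q5R (`equivariantChebotarevAtTwo_eigen_of_not_isSquare`) prescribes `(m, κ)`. [cite: McCallumLMS1991, §3 Cor. 3.2; §5 Prop. 5.2 (proof, (11)–(13))] -/
theorem infinite_kolyvaginPrime_localization_fullOrder_pair
    (N : ℕ) [NeZero N] (W : WeierstrassCurve ℚ) [W.IsElliptic] [W.IsGloballyMinimal]
    (hcm : ¬ W.HasCM) (hΔ : W.Δ < 0) (K : Type) [Field K] [NumberField K]
    (hK : IsImaginaryQuadratic K) (hns : ¬ IsSquare ((NumberField.discr K : ℚ) * -|W.Δ|))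
    (hρ : ∀ n : ℕ, W.HasSurjectiveModNGaloisRep (2 ^ n : ℕ)) (c : K ≃ₐ[ℚ] K) (hc : c ≠ 1)
    (M : ℕ) (hM : 1 ≤ M) (x y : galH1Torsion (W.baseChange K) ((2 ^ M : ℕ) : ℤ))
    {m κ : ℕ} (hm : 1 ≤ m) (hκ : 1 ≤ κ) (hx : addOrderOf x = 2 ^ m) (hy : addOrderOf y = 2 ^ κ)
    {sx sy : ℤ} (hsx : sx = 1 ∨ sx = -1) (hsy : sy = 1 ∨ sy = -1)
    (hτx : conjAct W c ((2 ^ M : ℕ) : ℤ) x = sx • x) (hτy : conjAct W c ((2 ^ M : ℕ) : ℤ) y = sy • y)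
    (hres : ∀ a b : ℤ, (∀ ρ ∈ torsionFixing (W.baseChange K) ((2 ^ M : ℕ) : ℤ),
      h1Eval (W.baseChange K) ((2 ^ M : ℕ) : ℤ) (a • x + b • y) ρ = 0) → a • x + b • y = 0) :
    Set.Infinite {ℓ : ℕ | FrobEqFrobInfty W K (2 ^ M) ℓ ∧ Zhang2014.IsKolyvaginPrime N W K 2 ℓ ∧
      M ≤ Zhang2014.kolyvaginIndex W 2 ℓ ∧
      ∀ v : HeightOneSpectrum (𝓞 K), (ℓ : 𝓞 K) ∈ v.asIdeal →
        (∀ j : ℕ, ((2 ^ j : ℕ) : ℤ) • x ∈ (W.baseChange K).torsionLocalKer (v.adicCompletion K) ((2 ^ M : ℕ) : ℤ) ↔ m ≤ j) ∧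
        ∀ j : ℕ, ((2 ^ j : ℕ) : ℤ) • y ∈ (W.baseChange K).torsionLocalKer (v.adicCompletion K) ((2 ^ M : ℕ) : ℤ) ↔ κ ≤ j} := by
  have hx0 : x ≠ 0 := ne_zero_of_addOrderOf_eq_two_pow hm hx
  have hy0 : y ≠ 0 := ne_zero_of_addOrderOf_eq_two_pow hκ hy
  by_cases hsoc : 2 ^ (m - 1) • x = 2 ^ (κ - 1) • y
  · -- equal socles: one class `x` with full prescribed order; the common socle transports full order to `y`
    have hQ := equivariantChebotarevAtTwo_eigen_of_not_isSquare N W hcm hΔ K hK hns hρ c hc M hM 1 ![x] ![sx]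
      (fun i ↦ by fin_cases i; exact hsx)
      (fun i ↦ by fin_cases i; exact hx0)
      (fun i ↦ by fin_cases i; exact hτx)
      (fun a ha i ↦ by
        fin_cases i
        simp only [Fin.sum_univ_one, Fin.isValue, Matrix.cons_val_zero] at ha
        show ((addOrderOf x : ℕ) : ℤ) ∣ a 0
        rw [addOrderOf_dvd_iff_zsmul_eq_zero]
        exact ha)
      (fun a ha ↦ by
        simp only [Fin.sum_univ_one, Fin.isValue, Matrix.cons_val_zero] at ha ⊢
        have h := hres (a 0) 0 (fun ρ hρ' ↦ by rw [zero_smul, add_zero]; exact ha ρ hρ')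
        rwa [zero_smul, add_zero] at h)
      ![m] (fun i ↦ by fin_cases i; exact hx) ![m]
      (fun i ↦ by fin_cases i; exact le_rfl)
    refine hQ.mono fun ℓ hℓ ↦ ⟨hℓ.1, hℓ.2.1, hℓ.2.2.1, fun v hv ↦ ?_⟩
    have hxv : ∀ j : ℕ, ((2 ^ j : ℕ) : ℤ) • x ∈
        (W.baseChange K).torsionLocalKer (v.adicCompletion K) ((2 ^ M : ℕ) : ℤ) ↔ m ≤ j := fun j ↦ by
      simpa using hℓ.2.2.2 0 v hv j
    refine ⟨hxv, pow_zsmul_mem_iff_of_socle_not_mem _ hκ hy ?_⟩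
    -- the common socle is not in the local kernel: it is `2^{m-1} • x` and `m ≤ m - 1` fails
    rw [natCast_zsmul, ← hsoc, ← natCast_zsmul]
    intro hmem
    have := (hxv (m - 1)).mp hmem
    omega
  · -- distinct socles: the independent pair `{x, y}`
    have hord : ∀ i : Fin 2, addOrderOf (![x, y] i) = 2 ^ (![m, κ] : Fin 2 → ℕ) i := fun i ↦ by
      fin_cases i
      · exact hx
      · exact hy
    have hQ := equivariantChebotarevAtTwo_eigen_of_not_isSquare N W hcm hΔ K hK hns hρ c hc M hM 2 ![x, y] ![sx, sy]
      (fun i ↦ by fin_cases i <;> assumption)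
      (fun i ↦ by fin_cases i <;> assumption)
      (fun i ↦ by fin_cases i <;> assumption)
      (fun a ha i ↦ by
        simp only [Fin.sum_univ_two, Fin.isValue, Matrix.cons_val_zero, Matrix.cons_val_one] at ha
        obtain ⟨h0, h1⟩ := dvd_of_zsmul_add_zsmul_eq_zero_of_socle_ne hm hκ hx hy hsoc ha
        rw [hord i]
        fin_cases i
        · exact h0
        · exact h1)
      (fun a ha ↦ by
        simp only [Fin.sum_univ_two, Fin.isValue, Matrix.cons_val_zero, Matrix.cons_val_one] at ha ⊢
        exact hres (a 0) (a 1) ha)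
      ![m, κ] hord ![m, κ] (fun i ↦ by fin_cases i <;> exact le_rfl)
    refine hQ.mono fun ℓ hℓ ↦ ⟨hℓ.1, hℓ.2.1, hℓ.2.2.1, fun v hv ↦ ⟨fun j ↦ ?_, fun j ↦ ?_⟩⟩
    · simpa using hℓ.2.2.2 0 v hv j
    · simpa using hℓ.2.2.2 1 v hv j

end Chebotarev

end Summit.BirchSwinnertonDyer.BirchSwinnertonDyer.Theorems.GenusExact.PlusDescent

end
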